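/-
Copyright (c) 2026. All rights reserved.
Released under Apache 2.0 license as described in the file LICENSE.
Authors: abc-iut cell — seat abc-iut-w4-d104 (gen 5): «KF-SEMIABELIAN-DEVISSAGE (algebra half)» for the
residual of node AbsTopIII:Rmk1.5.4(i) (L4-lead 2026-08-26T12:43:14Z).
-/
import Literature.AnabelianGeometry.AbsoluteAnabelian.AbsTopIII.KummerFaithful
import Mathlib.GroupTheory.Torsion
import Mathlib.GroupTheory.Exponent
import Mathlib.GroupTheory.QuotientGroup.Basic
import HarnessLib

/-!
# [AbsTopIII] Def. 1.5: condition (a) for an extension of groups (the semi-abelian dévissage)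

Proof-only companion (no definitions) to `AbsTopIII/KummerFaithful.lean` (S. Mochizuki, *Topics in
Absolute Anabelian Geometry III*, §1, Def. 1.5 p. 32, lit key `paper:url-5493eb38cbb7`).  Def. 1.5
quantifies condition (a) "`⋂_{N ≥ 1} N · A(k_H) = {0}`" over all SEMI-ABELIAN varieties `A` over the
finite extensions `k_H` of `k`; the tree predicate `IsKummerFaithful` records the two extreme cases
(tori, abelian varieties) and carries the note

> TODO(general form): an extension `0 → T → A → B → 0` reduces to the two cases when `B(k_H)` has
> finite torsion (true over sub-`p`-adic fields), not in general.

This file kernel-checks exactly that reduction as a statement about abstract commutative groups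
(written multiplicatively, like `DivisibleElementsTrivial`):

* `DivisibleElementsTrivial.of_extension` — if `T →f G →g B` has `f` injective and `ker g ≤ range f`,
  the torsion of `B` has bounded exponent `M`, and `T`, `B` satisfy (a), then `G` satisfies (a).
  Proof: an `x ∈ G` with `n`-th roots `y_n` for all `n` has `g x = 1` (condition (a) in `B`), so
  `x = f t`; `g (y_{Mn})` is `Mn`-torsion, so `y_{Mn} ^ M ∈ ker g = f(T)`, say `= f s`, and then
  `f (s ^ n) = x = f t` gives `t = s ^ n` for every `n ≥ 1`, whence `t = 1` by (a) in `T`.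
* `DivisibleElementsTrivial.of_extension_of_finite_torsion` — the same with "the torsion subgroup of
  `B` is finite" (exponent := `Monoid.exponent (CommGroup.torsion B)`), the form in which it is used
  for the `k_H`-points of a semi-abelian variety `0 → T → A → B → 0` over a sub-`p`-adic field
  (`B(k_H)_tors` finite).
* `DivisibleElementsTrivial.of_subgroup_of_quotient` — the subgroup/quotient phrasing
  (`T ≤ G`, `B = G ⧸ T`).

The `T`-side of the dévissage is free and already in the tree: condition (a) passes from `G` to any
group embedding into it (`DivisibleElementsTrivial.of_injective_monoidHom`,
`KummerFaithfulBaseChangeProofs.lean`); the quotient side does not inherit (a) in general.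

Nothing about semi-abelian varieties is typed here (no group-scheme notion of a semi-abelian variety
is in the tree): this is the ALGEBRA HALF of the TODO, after which the remaining debt is typing only.
Surrounding exact-sequence exactness at `T` (`g ∘ f = 1`) is not needed and not assumed.  Refereed
pre-IUT material; nothing here bears on the disputed [IUTchIII] Cor. 3.12; typed ≠ endorsed.
-/

namespace Literature.AnabelianGeometry.AbsoluteAnabelian.AbsTopIII

/-! ### Condition (a) along a group extension with torsion of bounded exponent in the quotient -/

/-- **Dévissage for condition (a) of [AbsTopIII] Def. 1.5** ("`⋂_{N ≥ 1} N · A = {0}`"), abstract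
form: let `T →f G →g B` be homomorphisms of commutative groups with `f` injective and `ker g ≤ range f`,
and suppose every torsion element of `B` is killed by a fixed `M ≥ 1`.  If `T` and `B` have no
nontrivial infinitely divisible element, then neither has `G`.  (This is the reduction of the
semi-abelian case `0 → T → A → B → 0` of Def. 1.5 to the torus and abelian-variety cases when
`B(k_H)` has finite torsion — the TODO(general form) of `IsKummerFaithful`.)
[cite: MochizukiAbsTopIII2015, Def 1.5 (a) p.32] -/
theorem DivisibleElementsTrivial.of_extension {T G B : Type*} [CommGroup T] [CommGroup G]
    [CommGroup B] (f : T →* G) (g : G →* B) (hf : Function.Injective f) (hker : g.ker ≤ f.range)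
    {M : ℕ} (hM : 0 < M) (htors : ∀ b : B, IsOfFinOrder b → b ^ M = 1)
    (hT : DivisibleElementsTrivial T) (hB : DivisibleElementsTrivial B) :
    DivisibleElementsTrivial G := by
  refine ⟨fun x hx => ?_⟩
  -- the image of `x` in `B` is infinitely divisible, hence trivial
  have hgx : g x = 1 := hB.eq_one_of_forall_exists_pow (g x) fun n hn => by
    obtain ⟨y, hy⟩ := hx n hn
    exact ⟨g y, by rw [← map_pow, hy]⟩
  -- so `x` comes from `T`
  obtain ⟨t, rfl⟩ := MonoidHom.mem_range.mp (hker (by rwa [MonoidHom.mem_ker]))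
  suffices ht : t = 1 by rw [ht, map_one]
  refine hT.eq_one_of_forall_exists_pow t fun n hn => ?_
  -- an `Mn`-th root `y` of `f t` in `G`: its image in `B` is `Mn`-torsion, so `y ^ M ∈ ker g`
  obtain ⟨y, hy⟩ := hx (M * n) (Nat.mul_pos hM hn)
  have hgy : g (y ^ M) = 1 := by
    rw [map_pow]
    refine htors (g y) (isOfFinOrder_iff_pow_eq_one.mpr ⟨M * n, Nat.mul_pos hM hn, ?_⟩)
    rw [← map_pow, hy, hgx]
  obtain ⟨s, hs⟩ := MonoidHom.mem_range.mp (hker (by rwa [MonoidHom.mem_ker]))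
  -- then `f (s ^ n) = y ^ (M n) = f t`, so `t = s ^ n`
  refine ⟨s, hf ?_⟩
  rw [map_pow, hs, ← pow_mul, hy]

/-- **Dévissage for condition (a) of [AbsTopIII] Def. 1.5, finite-torsion form**: as
`DivisibleElementsTrivial.of_extension`, with the bounded-exponent hypothesis supplied by finiteness
of the torsion subgroup of `B` (the situation of the `k_H`-points of `0 → T → A → B → 0` over a
sub-`p`-adic `k_H`, where `B(k_H)_tors` is finite). [cite: MochizukiAbsTopIII2015, Def 1.5 (a) p.32] -/
theorem DivisibleElementsTrivial.of_extension_of_finite_torsion {T G B : Type*} [CommGroup T]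
    [CommGroup G] [CommGroup B] (f : T →* G) (g : G →* B) (hf : Function.Injective f)
    (hker : g.ker ≤ f.range) [Finite (CommGroup.torsion B)]
    (hT : DivisibleElementsTrivial T) (hB : DivisibleElementsTrivial B) :
    DivisibleElementsTrivial G :=
  DivisibleElementsTrivial.of_extension f g hf hker
    (Nat.pos_of_ne_zero (Monoid.exponent_ne_zero_of_finite (G := CommGroup.torsion B)))
    (fun b hb => Submonoid.pow_exponent_eq_one (S := (CommGroup.torsion B).toSubmonoid)
      ((CommGroup.mem_torsion b).mpr hb))
    hT hB

/-- **Dévissage for condition (a) of [AbsTopIII] Def. 1.5, subgroup/quotient form**: if a subgroup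
`T ≤ G` and the quotient `G ⧸ T` have no nontrivial infinitely divisible element and the torsion
subgroup of `G ⧸ T` is finite, then `G` has no nontrivial infinitely divisible element.
[cite: MochizukiAbsTopIII2015, Def 1.5 (a) p.32] -/
theorem DivisibleElementsTrivial.of_subgroup_of_quotient {G : Type*} [CommGroup G]
    (T : Subgroup G) [Finite (CommGroup.torsion (G ⧸ T))]
    (hT : DivisibleElementsTrivial T) (hB : DivisibleElementsTrivial (G ⧸ T)) :
    DivisibleElementsTrivial G :=
  DivisibleElementsTrivial.of_extension_of_finite_torsion T.subtype (QuotientGroup.mk' T)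
    T.subtype_injective (by rw [QuotientGroup.ker_mk', Subgroup.range_subtype]) hT hB

end Literature.AnabelianGeometry.AbsoluteAnabelian.AbsTopIII
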